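import Literature.AnabelianGeometry.SemiGraphs.ArithContinuityOfFiniteIndexOpen
import Literature.AnabelianGeometry.SemiGraphs.ArithBTempLevelKerComparison
import HarnessLib

/-!
# [SemiAnbd] Thm 5.4 (iii): CONTINUITY of the arithmetic `B^temp(φ)` between the tempered level topologies of
# the outer models, MODULO Nikolov–Segal ([IUTchI] Rmk 2.5.3 (vi) (O3)) — the design binder `hcont` discharged

Mochizuki, *Semi-graphs of anabelioids*, Publ. RIMS **42** (2006), §5 Def 5.1 (i)(a)(c) p. 62, Prop 5.2 (iv)
p. 64, Thm 5.4 (iii) p. 66 ("arithmetically quasi-geometric morphisms of temperoids `B^temp(𝔊) → B^temp(ℍ)`");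
§3 Thm 3.7 (ii) p. 40; Mochizuki, *IUTchI* Rmk 2.5.3 (vi) (O3) p. 56 ("since `H` is topologically finitely
generated … [NS], Theorem 1.1 … every finite index subgroup of `H` is open in `H` … Thus, the conditions (c) and
(c^new) in fact hold automatically") [cite: MochizukiSemiAnbd2006, Thm 5.4 (iii), p. 66].

abc-iut cell, D-0079 L-F sub-cell [SemiAnbd]+[CombGC] pack B, row F-1922 (Thm 5.4 (iii) at the outer models);
seat abc-iut-w4-d071 (gen 5); helper H3′ of the integrated Thm 5.4 line (theorem of record
`arithThm54_outerModels_chart_of_producers_anyRepresentatives`, p447359), whose design binder `hcont` it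
discharges modulo [NS].  PROOF-ONLY: no definition, no schema restated.

WHAT IS PROVED (`continuous_outerModelHom_of_finiteIndexOpenOfTopFG`).  For the outer models
`E = π₁^temp(𝒢) ⋊^out Π_A`, `E′ = π₁^temp(ℋ) ⋊^out Π_{A′}` with the tempered LEVEL topologies of abc-iut-w6-d070
(`arithLevelTopology`, neighbourhood basis `levelKer (N n) ⊓ aug⁻¹U`), EVERY homomorphism `B : E → E′` which
(1) restricts on the geometric parts to a chart-level representative `φ̂` of a LOCALLY OPEN `F : 𝒢 → ℋ`
(`F^*_θ ≅ B^temp(φ̂)`, so `φ̂ ∘ ψ_v = conj c₀ ∘ ψ_w ∘ F_v`), (2) transports the `Aut`-components along `φ̂`,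
(3) covers a continuous `e : Π_A → Π_{A′}`, IS CONTINUOUS — provided `Π_A` is a topologically finitely generated
profinite group (Def 5.1 (i)(a); a theorem of every `ArithSemiGraph`, abc-iut-w4-d059 `ArithSemiGraph.def51CondA`)
and [NS] holds (`FiniteIndexOpenOfTopFG`, FACT F-1977, BY NAME).  Route = print's (O3) mechanism made explicit:
for a target level `levelKer′(N′ m)`, pick `n` with `ι⁻¹(levelKer (N n)) ≤ φ̂⁻¹(N′ m)`
(`exists_comap_levelKer_le`); on the open subgroup `O = levelKer (N n) ⊓ aug⁻¹ e⁻¹(aug′ levelKer′(N′ m))` the map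
`B` mod `levelKer′(N′ m)` lands in the finite set `[ι′(c₀ H′_w c₀⁻¹)]` (`exists_map_eq_mul_conj_vertGp_mul`), so
`S = B⁻¹(levelKer′(N′ m))` meets `O` with finite index and contains `O ∩ ker aug`; hence `S ∩ O` is the preimage
of a finite-index subgroup of the open, topologically finitely generated profinite `aug(O) ≤ Π_A` — OPEN by
[NS] — and `S` is a neighbourhood of `1`; the `Π_{A′}`-part of the basis is handled by the continuity of `e`.
HONEST STATUS: conditional on [NS] by name (a refereed theorem).  ERRATUM (v2, docstring only; abc-iut-L3-lead
gen 6 ruling 2026-08-26T17:46:43Z): v1 of this docstring claimed that without a strong-completeness input the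
statement is not derivable from the other binders — that claim is WRONG and is withdrawn: the continuity is
derivable HYPOTHESIS-FREE (no [NS], no finite generation of `Π_A`) — abc-iut-w4-d089
`continuous_outerSemidirectProductMap_of_levelKer` (`ArithBTempOuterModelContinuous.lean`, p455596): comparing
at a DEEPER target level `m₁` and using the compactness of the commensurably terminal vertex group pins the free
element directly into `ι′⁻¹(levelKer′ (N′ m))`, with no index argument.  The theorem below is therefore a
SUPERSEDED VARIANT carrying the superfluous binder `hNS`; it is kept as the explicit [IUTchI] Rmk 2.5.3 (vi)(O3)
route.  Nothing here bears on [IUTchIII] Cor. 3.12; typed ≠ proved elsewhere.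
-/

namespace Literature.AnabelianGeometry.SemiGraphs

namespace ProfiniteSemiGraph

open CategoryTheory Topology Filter
open Literature.AnabelianGeometry.EtaleTheta
open Literature.AnabelianGeometry.AbsoluteAnabelian

universe u

variable {𝒢 : ProfiniteSemiGraph.{u}} (c : TemperedPiChart 𝒢)
  {PA : Type u} [Group PA] [TopologicalSpace PA] [IsTopologicalGroup PA]
  (ρ : PA →* TopOut c.G) (baseAct : PA →* Aut 𝒢.graph)

/-! ### The continuity theorem -/

section Continuity

variable [FirstCountableTopology c.G] [CompactSpace PA] [TotallyDisconnectedSpace PA]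
  (h36 : 𝒢.Prop36Hypotheses) (hA : IsTempered PA)
  (P : SemiGraph.SubgroupPresentation 𝒢.graph c.G)
  (hP : P.IsArithCompatible
    (((contMulAut c.G).subtype.comp (MonoidHom.fst (contMulAut c.G) PA)).comp
      (outerSemidirectProduct ρ).subtype)
    (baseAct.comp (outerSemidirectProductSnd ρ)))
  (w₀ : 𝒢.graph.Vertex) (hcpt : IsCompact (P.H w₀ : Set c.G))
  (N : ℕ → Subgroup c.G) (hNn : ∀ n, (N n).Normal)
  (hNst : ∀ (n : ℕ) (e : outerSemidirectProduct ρ) (x : c.G), x ∈ N n →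
    (((contMulAut c.G).subtype.comp (MonoidHom.fst (contMulAut c.G) PA)).comp
      (outerSemidirectProduct ρ).subtype) e x ∈ N n)
  (hNanti : Antitone N) (hNopen : ∀ n, IsOpen (N n : Set c.G))
  (hNcof : ∀ U ∈ 𝓝 (1 : c.G), ∃ n, (N n : Set c.G) ⊆ U)
  (hK1' : ∀ n, IsOpen (((P.levelKer hP (N n) (hNst n)).map (outerSemidirectProductSnd ρ) :
    Subgroup PA) : Set PA))
  -- Def 5.1 (i)(a) for `Π_A` and [NS]
  (htfg : IsTopologicallyFinitelyGenerated PA)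
  (hNS : Literature.IUT.HodgeTheaters.Rmk253.FiniteIndexOpenOfTopFG.{u})
  -- the `ℍ′` side
  {ℋ : ProfiniteSemiGraph.{u}} (c' : TemperedPiChart ℋ) [FirstCountableTopology c'.G]
  {PA' : Type u} [Group PA'] [TopologicalSpace PA'] [IsTopologicalGroup PA']
  (ρ' : PA' →* TopOut c'.G) (baseAct' : PA' →* Aut ℋ.graph) (h36' : ℋ.Prop36Hypotheses)
  (hA' : IsTempered PA') (P' : SemiGraph.SubgroupPresentation ℋ.graph c'.G)
  (hP' : P'.IsArithCompatible
    (((contMulAut c'.G).subtype.comp (MonoidHom.fst (contMulAut c'.G) PA')).comp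
      (outerSemidirectProduct ρ').subtype)
    (baseAct'.comp (outerSemidirectProductSnd ρ')))
  (w₀' : ℋ.graph.Vertex) (hcpt' : IsCompact (P'.H w₀' : Set c'.G))
  (N' : ℕ → Subgroup c'.G) (hNn' : ∀ n, (N' n).Normal)
  (hNst' : ∀ (n : ℕ) (e : outerSemidirectProduct ρ') (x : c'.G), x ∈ N' n →
    (((contMulAut c'.G).subtype.comp (MonoidHom.fst (contMulAut c'.G) PA')).comp
      (outerSemidirectProduct ρ').subtype) e x ∈ N' n)
  (hNanti' : Antitone N') (hNopen' : ∀ n, IsOpen (N' n : Set c'.G))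
  (hNcof' : ∀ U ∈ 𝓝 (1 : c'.G), ∃ n, (N' n : Set c'.G) ⊆ U)
  (hK1'' : ∀ n, IsOpen (((P'.levelKer hP' (N' n) (hNst' n)).map (outerSemidirectProductSnd ρ') :
    Subgroup PA') : Set PA'))
  -- the arrow: a locally open `F : 𝒢 → ℋ` with chart-level representative `φ̂`, a vertex `v` at which the
  -- presentations' vertex groups are verticial, the conjugator `c₀`
  (h37' : ℋ.Thm37Hypotheses) (F : Hom 𝒢 ℋ) (hF : F.IsLocallyOpen) (φc : c.G →ₜ* c'.G)
  (v : 𝒢.graph.Vertex) (ψv : 𝒢.Gv v →ₜ* c.G) (hψv : ψv.toMonoidHom.range = P.H v)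
  (ψw : ℋ.Gv (F.base.vertexMap v) →ₜ* c'.G) (hψw : IsVerticialHom c' (F.base.vertexMap v) ψw)
  (hψw' : ψw.toMonoidHom.range = P'.H (F.base.vertexMap v))
  (c₀ : c'.G) (hc₀ : ∀ t, φc (ψv t) = c₀ * ψw (F.hV v t) * c₀⁻¹)
  -- `B` over a continuous `e`: restriction to `φ̂`, transport of `Aut`-components, covering
  (e : PA →* PA') (he : Continuous e) (B : outerSemidirectProduct ρ →* outerSemidirectProduct ρ')
  (hBι : ∀ g : c.G, B (toOuterSemidirectProduct ρ g) = toOuterSemidirectProduct ρ' (φc g))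
  (hBfst : ∀ (x : outerSemidirectProduct ρ) (y : c.G),
    ((B x).1.1 : MulAut c'.G) (φc y) = φc ((x.1.1 : MulAut c.G) y))
  (hBaug : ∀ x, outerSemidirectProductSnd ρ' (B x) = e (outerSemidirectProductSnd ρ x))

include h36 hA hcpt hNn hNanti hNopen hNcof hK1' htfg hNS h36' hA' hcpt' hNn' hNanti' hNopen' hNcof' hK1''
  h37' hF hψv hψw hψw' hc₀ he hBι hBfst hBaug

/-- **[SemiAnbd] Thm 5.4 (iii): the arithmetic `B^temp(φ)` is CONTINUOUS for the tempered level topologies of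
the outer models, modulo [NS]** ([IUTchI] Rmk 2.5.3 (vi) (O3)).  For every homomorphism
`B : π₁^temp(𝒢) ⋊^out Π_A → π₁^temp(ℋ) ⋊^out Π_{A′}` restricting to the chart-level representative `φ̂` of a
locally open `F : 𝒢 → ℋ` on the geometric parts, transporting the `Aut`-components along `φ̂`, and covering a
continuous `e : Π_A → Π_{A′}`: `B` is continuous from `arithLevelTopology` to `arithLevelTopology`, PROVIDED
`Π_A` is a topologically finitely generated profinite group (Def 5.1 (i)(a)) and finite-index subgroups of
topologically finitely generated profinite groups are open ([NS] Thm 1.1 = `FiniteIndexOpenOfTopFG`, by name).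
[cite: MochizukiSemiAnbd2006, Thm 5.4 (iii), p. 66] -/
theorem continuous_outerModelHom_of_finiteIndexOpenOfTopFG :
    Continuous[arithLevelTopology c ρ baseAct h36 hA P hP w₀ hcpt N hNn hNst hNanti hNopen hNcof hK1',
      arithLevelTopology c' ρ' baseAct' h36' hA' P' hP' w₀' hcpt' N' hNn' hNst' hNanti' hNopen' hNcof' hK1''] B := by
  classical
  letI τ := arithLevelTopology c ρ baseAct h36 hA P hP w₀ hcpt N hNn hNst hNanti hNopen hNcof hK1'
  letI τ' := arithLevelTopology c' ρ' baseAct' h36' hA' P' hP' w₀' hcpt' N' hNn' hNst' hNanti' hNopen' hNcof' hK1''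
  haveI : IsTopologicalGroup (outerSemidirectProduct ρ) :=
    arithLevelTopology_isTopologicalGroup c ρ baseAct h36 hA P hP w₀ hcpt N hNn hNst hNanti hNopen hNcof hK1'
  haveI : IsTopologicalGroup (outerSemidirectProduct ρ') :=
    arithLevelTopology_isTopologicalGroup c' ρ' baseAct' h36' hA' P' hP' w₀' hcpt' N' hNn' hNst' hNanti' hNopen'
      hNcof' hK1''
  -- abbreviations
  set ι := toOuterSemidirectProduct ρ with hιdef
  set ι' := toOuterSemidirectProduct ρ' with hι'def
  set aug := outerSemidirectProductSnd ρ with haugdef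
  set aug' := outerSemidirectProductSnd ρ' with haug'def
  have haugc : Continuous aug :=
    continuous_outerSemidirectProductSnd c ρ baseAct h36 hA P hP w₀ hcpt N hNn hNst hNanti hNopen hNcof hK1'
  have haugo : IsOpenMap aug :=
    isOpenMap_outerSemidirectProductSnd c ρ baseAct h36 hA P hP w₀ hcpt N hNn hNst hNanti hNopen hNcof hK1'
  obtain ⟨hιinj, hex, -⟩ := outerAction_exact c ρ h36
  have hιΦ' : ∀ g : c'.G,
      (((contMulAut c'.G).subtype.comp (MonoidHom.fst (contMulAut c'.G) PA')).comp
        (outerSemidirectProduct ρ').subtype) (ι' g) = MulAut.conj g := fun g => rfl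
  have hισ' : ∀ g : c'.G, (baseAct'.comp aug') (ι' g) = 1 := fun g => by simp [haug'def, hι'def]
  refine ArithContinuity.continuous_of_preimage_mem_nhds_of_hasBasis
    (arithLevelTopology_nhds_hasBasis c' ρ' baseAct' h36' hA' P' hP' w₀' hcpt' N' hNn' hNst' hNanti' hNopen'
      hNcof' hK1'') B ?_
  rintro ⟨m, U''⟩ -
  -- notation for the target level
  set L' := P'.levelKer hP' (N' m) (hNst' m) with hL'def
  haveI hL'n : L'.Normal := P'.levelKer_normal hP' (N' m) (hNst' m)
  haveI := hNn' m
  have hι'L : ∀ g ∈ N' m, ι' g ∈ L' := fun g hg =>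
    P'.le_comap_levelKer hP' (N' m) (hNst' m) ι' hιΦ' hισ' hg
  set S : Subgroup (outerSemidirectProduct ρ) := L'.comap B with hSdef
  -- ── (1) `S := B⁻¹(levelKer′ m)` is a neighbourhood of `1` ──
  have hS : (S : Set (outerSemidirectProduct ρ)) ∈ 𝓝 (1 : outerSemidirectProduct ρ) := by
    -- the open subgroup `W = φ̂⁻¹(N′ m)` and a level `n` with `ι⁻¹(levelKer n) ≤ W`
    set W : Subgroup c.G := (N' m).comap φc.toMonoidHom with hWdef
    have hW : IsOpen (W : Set c.G) := (hNopen' m).preimage φc.continuous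
    obtain ⟨n, hn⟩ := exists_comap_levelKer_le c ρ baseAct h36 P hP w₀ hcpt N hNn hNst hNanti hNopen hNcof W hW
    haveI := hNn n
    set L := P.levelKer hP (N n) (hNst n) with hLdef
    -- the open subgroup `O`
    set O : Subgroup (outerSemidirectProduct ρ) :=
      L ⊓ ((L'.map aug').comap (e.comp aug)) with hOdef
    have hOopen : IsOpen (O : Set (outerSemidirectProduct ρ)) := by
      rw [hOdef, Subgroup.coe_inf]
      refine (isOpen_levelKer c ρ baseAct h36 hA P hP w₀ hcpt N hNn hNst hNanti hNopen hNcof hK1' n).inter ?_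
      exact ((hK1'' m).preimage he).preimage haugc
    -- (i) `O ∩ ker aug ≤ S`
    have hOS : ∀ x ∈ O, aug x = 1 → x ∈ S := by
      intro x hxO hx1
      have hxker : x ∈ aug.ker := hx1
      rw [← hex] at hxker
      obtain ⟨g, rfl⟩ := hxker
      have hgW : g ∈ W := hn (Subgroup.mem_comap.mpr (Subgroup.mem_inf.mp hxO).1)
      change B (ι g) ∈ L'
      rw [hBι]
      exact hι'L _ hgW
    -- (ii) `S ∩ O` has finite index in `O`: `B` mod `levelKer′ m` has finite image on `O`
    haveI hfin : (S.subgroupOf O).FiniteIndex := by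
      -- the finite comparison group `f(H′_w)`
      let f : ↥(P'.H (F.base.vertexMap v)) →* outerSemidirectProduct ρ' ⧸ L' :=
        (QuotientGroup.mk' L').comp (ι'.comp (((MulAut.conj c₀).toMonoidHom).comp
          (P'.H (F.base.vertexMap v)).subtype))
      have hfapply : ∀ h : ↥(P'.H (F.base.vertexMap v)),
          f h = QuotientGroup.mk' L' (ι' (c₀ * h * c₀⁻¹)) := fun h => rfl
      -- `f` kills the open `N′ m ∩ H′_w`, of finite index in the compact `H′_w`
      have hHc : IsCompact (P'.H (F.base.vertexMap v) : Set c'.G) := by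
        have : (P'.H (F.base.vertexMap v) : Set c'.G) = Set.range ψw := by
          rw [← hψw']; ext; simp
        rw [this]
        exact isCompact_range ψw.continuous
      haveI hcptH : CompactSpace ↥(P'.H (F.base.vertexMap v)) := isCompact_iff_compactSpace.mp hHc
      haveI : ((N' m).subgroupOf (P'.H (F.base.vertexMap v))).FiniteIndex :=
        ArithOpenness.finiteIndex_of_isOpen_of_compactSpace _ ((hNopen' m).preimage continuous_subtype_val)
      have hkerle : (N' m).subgroupOf (P'.H (F.base.vertexMap v)) ≤ f.ker := by
        intro h hh
        rw [MonoidHom.mem_ker, hfapply, QuotientGroup.mk'_apply, QuotientGroup.eq_one_iff]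
        refine hι'L _ ?_
        exact (hNn' m).conj_mem _ (Subgroup.mem_subgroupOf.mp hh) c₀
      haveI : f.ker.FiniteIndex := Subgroup.finiteIndex_of_le hkerle
      haveI hfr : Finite f.range :=
        Finite.of_equiv _ (QuotientGroup.quotientKerEquivRange f).toEquiv
      -- `B` mod `L′` on `O` lands in `range f`
      let βO : ↥O →* outerSemidirectProduct ρ' ⧸ L' := (QuotientGroup.mk' L').comp (B.comp O.subtype)
      have hβle : βO.range ≤ f.range := by
        rintro _ ⟨x, rfl⟩
        have hxL : (x : outerSemidirectProduct ρ) ∈ L := (Subgroup.mem_inf.mp x.2).1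
        have hx' : e (aug x) ∈ L'.map aug' := (Subgroup.mem_inf.mp x.2).2
        obtain ⟨h, hh, l₁, hl₁, l₂, hl₂, hBx⟩ :=
          exists_map_eq_mul_conj_vertGp_mul c ρ baseAct P hP N hNn hNst c' ρ' baseAct' P' hP' N' hNn' hNst'
            h37' F hF φc v ψv hψv ψw hψw hψw' c₀ hc₀ e B hBfst hBaug
            (n := n) (m := m) (fun g hg => hn (Subgroup.mem_comap.mpr
              (P.le_comap_levelKer hP (N n) (hNst n) ι (fun g => rfl) (fun g => by simp [haugdef, hιdef]) hg)))
            hxL hx'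
        refine ⟨⟨h, hh⟩, ?_⟩
        change f ⟨h, hh⟩ = QuotientGroup.mk' L' (B x)
        rw [hfapply, hBx, map_mul (QuotientGroup.mk' L'), map_mul (QuotientGroup.mk' L')]
        simp only [QuotientGroup.mk'_apply]
        rw [(QuotientGroup.eq_one_iff l₁).mpr hl₁, (QuotientGroup.eq_one_iff l₂).mpr hl₂, one_mul, mul_one]
      haveI : Finite βO.range :=
        Finite.of_injective _ (Subgroup.inclusion_injective hβle)
      haveI : Finite (↥O ⧸ βO.ker) :=
        Finite.of_equiv _ (QuotientGroup.quotientKerEquivRange βO).symm.toEquiv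
      have hkereq : βO.ker = S.subgroupOf O := by
        ext x
        rw [MonoidHom.mem_ker, Subgroup.mem_subgroupOf, hSdef, Subgroup.mem_comap]
        exact QuotientGroup.eq_one_iff _
      rw [← hkereq]
      exact Subgroup.finiteIndex_of_finite_quotient
    -- (iii) [NS] at the open subgroup `aug(O) ≤ Π_A`
    set U : Subgroup PA := O.map aug with hUdef
    have hUopen : IsOpen (U : Set PA) := by
      rw [hUdef, Subgroup.coe_map]; exact haugo _ hOopen
    haveI : CompactSpace ↥U := isCompact_iff_compactSpace.mp (U.isClosed_of_isOpen hUopen).isCompact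
    have htfgU : IsTopologicallyFinitelyGenerated ↥U := htfg.subgroup_isOpen U hUopen
    let augO : ↥O →* ↥U := aug.subgroupMap O
    have haugO : Function.Surjective augO := aug.subgroupMap_surjective O
    set TU : Subgroup ↥U := (S.subgroupOf O).map augO with hTUdef
    have hTUidx : TU.index ≠ 0 := fun h0 =>
      (S.subgroupOf O).index_ne_zero_of_finite
        (Nat.eq_zero_of_zero_dvd (h0 ▸ Subgroup.index_map_dvd _ haugO))
    haveI : TU.FiniteIndex := ⟨hTUidx⟩
    have hTUopen : IsOpen (TU : Set ↥U) := hNS (ProfiniteGrp.of ↥U) htfgU TU inferInstance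
    -- the open set `O ∩ aug⁻¹(TU) ∋ 1` lies in `S`
    set T : Set PA := ((↑) : ↥U → PA) '' (TU : Set ↥U) with hTdef
    have hTopen : IsOpen T := hUopen.isOpenEmbedding_subtypeVal.isOpenMap _ hTUopen
    refine mem_nhds_iff.mpr ⟨(O : Set _) ∩ aug ⁻¹' T, ?_, hOopen.inter (hTopen.preimage haugc), ?_⟩
    · rintro x ⟨hxO, ⟨u, huTU, hux⟩⟩
      obtain ⟨s, hsS, hsu⟩ := huTU
      have haugs : aug (s : outerSemidirectProduct ρ) = aug x := by
        rw [← hux, ← hsu]; rfl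
      have h1 : (s : outerSemidirectProduct ρ)⁻¹ * x ∈ S :=
        hOS _ (O.mul_mem (O.inv_mem s.2) hxO) (by rw [map_mul, map_inv, haugs, inv_mul_cancel])
      have := S.mul_mem (Subgroup.mem_subgroupOf.mp hsS) h1
      rwa [mul_inv_cancel_left] at this
    · refine ⟨O.one_mem, ⟨1, TU.one_mem, ?_⟩⟩
      rw [map_one]; rfl
  -- ── (2) the `Π_{A′}`-part: `B⁻¹(aug′⁻¹ U″) = aug⁻¹(e⁻¹ U″)` is open ──
  have hU : ((U''.toSubgroup.comap (aug'.comp B) : Subgroup (outerSemidirectProduct ρ)) :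
      Set (outerSemidirectProduct ρ)) ∈ 𝓝 (1 : outerSemidirectProduct ρ) := by
    refine IsOpen.mem_nhds ?_ (Subgroup.one_mem _)
    have : ((U''.toSubgroup.comap (aug'.comp B) : Subgroup (outerSemidirectProduct ρ)) :
        Set (outerSemidirectProduct ρ)) = aug ⁻¹' (e ⁻¹' (U'' : Set PA')) := by
      ext x
      simp only [SetLike.mem_coe, Subgroup.mem_comap, MonoidHom.coe_comp, Function.comp_apply, hBaug,
        Set.mem_preimage]
      rfl
    rw [this]
    exact (U''.isOpen.preimage he).preimage haugc
  -- assemble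
  have hpre : B ⁻¹' ((L' ⊓ U''.toSubgroup.comap aug' : Subgroup (outerSemidirectProduct ρ')) :
      Set (outerSemidirectProduct ρ')) =
      (S : Set (outerSemidirectProduct ρ)) ∩
        ((U''.toSubgroup.comap (aug'.comp B) : Subgroup (outerSemidirectProduct ρ)) :
          Set (outerSemidirectProduct ρ)) := by
    ext x
    simp only [Set.mem_preimage, SetLike.mem_coe, Subgroup.mem_inf, hSdef, Subgroup.mem_comap,
      MonoidHom.coe_comp, Function.comp_apply, Set.mem_inter_iff]
  rw [hpre]
  exact Filter.inter_mem hS hU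

end Continuity

end ProfiniteSemiGraph

end Literature.AnabelianGeometry.SemiGraphs
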